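import Summits.HodgeConjecture.HodgeConjecture.Theses.PadicSemiregularLift
import Literature.AlgebraicGeometry.HodgeTheory.AlgebraicityLocus
import Literature.AlgebraicGeometry.Motives.ComplexPointsManifold

/-!
# `HodgeLocusPropagation` (route `HodgeConjecture/PadicSemiregularLift`, support item
# stmt-HodgeConjecture-14977) in the PRINTED setting: `f₀` a projective morphism

The route decl `HodgeLocusPropagation` asks: for `σ : ℚ̄ →+* ℂ`, a morphism `f₀ : 𝒳₀ ⟶ S₀` of
`ℚ̄`-schemes with `S₀` quasi-projective (inlined: an open `ℚ̄`-immersion into a projective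
`ℚ̄`-scheme) and irreducible, whose complexification `f = f₀ ⊗_σ ℂ` is a smooth projective family of
relative dimension `n` (`Motives.IsSmoothProjectiveFamily`: smooth, proper, smooth projective
geometrically irreducible fibres), a global class `A ∈ H²ᵖ(𝒳(ℂ); ℂ)` and a `ℚ̄`-GENERIC
`s ∈ S(ℂ)`: if `A|_{𝒳_s}` is algebraic then `A|_{𝒳_t}` is algebraic for every `t ∈ S(ℂ)`.

The printed sources (Voisin 2007, §0 and §3; Charles–Schnell 2014, Prop. 11.3.11 / Lemma 11.3.14)
work with a PROJECTIVE MORPHISM `π : 𝒳 → T` of quasi-projective varieties (relative Hilbert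
schemes), which on the tree's carriers is `IsQuasiProjectiveOver 𝒳₀` + properness of `f` (EGA II
5.5.3). The tree's vendored named fact
`Literature.AlgebraicGeometry.HodgeTheory.voisin2007_algebraicityLocus_iUnion_qbarClosed` carries
exactly that hypothesis, and its proved corollary `….mem_of_qbarGeneric` is the route decl WITH the
extra binder `IsQuasiProjectiveOver 𝒳₀`. The route decl as typed (no hypothesis on `𝒳₀`: `f₀` merely
proper with projective fibres — a genuinely wider class, e.g. a non-polarisable first-order
deformation `𝒳₀ → Spec ℚ̄[ε]` of an abelian surface satisfies every hypothesis with `𝒳₀` not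
quasi-projective) is TRUE at proof level (spread the cycles of `𝒳_s` over a dominant `S'' → S₀`,
rigidity of flat sections over the connected `S''(ℂ)`, specialisation of flat cycle closures over
curves, Fulton 1998 §20.3) but has no printed statement-level source and none of its ingredients
(relative cycles and their Betti fundamental classes, Ehresmann, analytic connectedness) in the tree.

This file lands the printed-setting version, binder-for-binder the route decl plus ONE hypothesis
(the first), conditional on the vendored fact:

* `HodgeLocusPropagation_of_isQuasiProjective` — CONDITIONAL on
  `voisin2007_algebraicityLocus_iUnion_qbarClosed`; the proof is `mem_of_qbarGeneric`.
* `HodgeLocusPropagation_isQuasiProjective_of_HodgeLocusPropagation` — the printed-setting version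
  is a weakening of the route decl (sanity direction, unconditional).
* `HodgeLocusPropagation_of_lt`, `HodgeLocusPropagation_zero`,
  `HodgeLocusPropagation_of_eq_zero_or_lt` — the trivial degree ranges `p > n` (`H²ᵖ(𝒳_t(ℂ)) = 0`,
  closed `2n`-manifold) and `p = 0` (`N⁰ H⁰ = H⁰`) of the route decl for ALL `𝒳₀`, `S₀`, `s`,
  UNCONDITIONALLY.

References: [Voisin2007HodgeLoci] §0 first paragraph, §3 (proof of Prop. 1.2);
[CharlesSchnell2014Notes] Prop. 11.3.11 (proof), Lemma 11.3.14; [Fulton1998] §10.1, §20.3.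
-/

set_option linter.dupNamespace false

namespace Summit.HodgeConjecture.HodgeConjecture.Theorems

open CategoryTheory AlgebraicGeometry
open Literature.AlgebraicGeometry Literature.AlgebraicGeometry.HodgeTheory
  Literature.AlgebraicGeometry.Motives

/-- **`HodgeLocusPropagation` in the printed setting** (Voisin 2007, §0; Charles–Schnell 2014,
Prop. 11.3.11 and Lemma 11.3.14: a PROJECTIVE morphism of quasi-projective `ℚ̄`-varieties, rendered
as the extra first hypothesis "`𝒳₀` quasi-projective over `ℚ̄`", inlined as an open `ℚ̄`-immersion
into a projective `ℚ̄`-scheme exactly as the route inlines it for `S₀`): for `σ : ℚ̄ →+* ℂ`,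
`f₀ : 𝒳₀ ⟶ S₀` over `ℚ̄` with `𝒳₀` AND `S₀` quasi-projective, `S₀` irreducible, whose
complexification is a smooth projective family of relative dimension `n`, a global class
`A ∈ H²ᵖ(𝒳(ℂ); ℂ)` algebraic on the fibre at a `ℚ̄`-generic `s ∈ S(ℂ)` is algebraic on every
fibre. CONDITIONAL on the named fact `voisin2007_algebraicityLocus_iUnion_qbarClosed` (the
algebraicity locus of a global class is a countable union of closed `ℚ̄`-subvarieties of `S₀`),
through its proved corollary `mem_of_qbarGeneric` (a `ℚ̄`-generic point lies over the generic
point of `S₀`; closed `W_j ∋ η` is everything). Dropping the first hypothesis gives the route decl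
`PadicSemiregularLift.HodgeLocusPropagation` verbatim. -/
theorem HodgeLocusPropagation_of_isQuasiProjective
    (hV : voisin2007_algebraicityLocus_iUnion_qbarClosed) :
    ∀ (σ : AlgebraicClosure ℚ →+* ℂ) ⦃𝒳₀ S₀ : SchemeOver (AlgebraicClosure ℚ)⦄ (f₀ : 𝒳₀ ⟶ S₀)
      (n p : ℕ),
      (∃ (P : SchemeOver (AlgebraicClosure ℚ)) (j : 𝒳₀ ⟶ P),
          IsProjectiveOver P ∧ IsOpenImmersion j.left) →
      (∃ (P : SchemeOver (AlgebraicClosure ℚ)) (j : S₀ ⟶ P),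
          IsProjectiveOver P ∧ IsOpenImmersion j.left) →
      IrreducibleSpace S₀.left →
      IsSmoothProjectiveFamily ((baseChangeHom σ).map f₀) n →
      ∀ (A : complexBetti ((baseChangeHom σ).obj 𝒳₀) (2 * p))
        (s : ComplexPoints ((baseChangeHom σ).obj S₀)),
        (∀ Z : Set (ComplexPoints ((baseChangeHom σ).obj S₀)),
            IsDefinedOverQbar σ S₀ Z → s ∈ Z → Z = Set.univ) →
        complexBetti.map (fiberι ((baseChangeHom σ).map f₀) s) (2 * p) A ∈
          algebraicClasses (fiberOver ((baseChangeHom σ).map f₀) s) p →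
        ∀ t : ComplexPoints ((baseChangeHom σ).obj S₀),
          complexBetti.map (fiberι ((baseChangeHom σ).map f₀) t) (2 * p) A ∈
            algebraicClasses (fiberOver ((baseChangeHom σ).map f₀) t) p := by
  intro σ 𝒳₀ S₀ f₀ n p h𝒳₀ hS₀ _hirr hf A s hs hA t
  exact voisin2007_algebraicityLocus_iUnion_qbarClosed.mem_of_qbarGeneric hV σ f₀ h𝒳₀ hS₀ hf A hs
    hA t

/-- The printed-setting version is a WEAKENING of the route decl (it has one more hypothesis,
`𝒳₀` quasi-projective): `HodgeLocusPropagation` implies it outright, unconditionally. Recorded so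
that a restatement of the item to the printed setting is visibly implied by the present one.
[folklore] -/
theorem HodgeLocusPropagation_isQuasiProjective_of_HodgeLocusPropagation
    (h : Summit.HodgeConjecture.HodgeConjecture.Theses.PadicSemiregularLift.HodgeLocusPropagation)
    (σ : AlgebraicClosure ℚ →+* ℂ) ⦃𝒳₀ S₀ : SchemeOver (AlgebraicClosure ℚ)⦄ (f₀ : 𝒳₀ ⟶ S₀)
    (n p : ℕ)
    (_h𝒳₀ : ∃ (P : SchemeOver (AlgebraicClosure ℚ)) (j : 𝒳₀ ⟶ P),
        IsProjectiveOver P ∧ IsOpenImmersion j.left)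
    (hS₀ : ∃ (P : SchemeOver (AlgebraicClosure ℚ)) (j : S₀ ⟶ P),
        IsProjectiveOver P ∧ IsOpenImmersion j.left)
    (hirr : IrreducibleSpace S₀.left)
    (hf : IsSmoothProjectiveFamily ((baseChangeHom σ).map f₀) n)
    (A : complexBetti ((baseChangeHom σ).obj 𝒳₀) (2 * p))
    (s : ComplexPoints ((baseChangeHom σ).obj S₀))
    (hs : ∀ Z : Set (ComplexPoints ((baseChangeHom σ).obj S₀)),
        IsDefinedOverQbar σ S₀ Z → s ∈ Z → Z = Set.univ)
    (hA : complexBetti.map (fiberι ((baseChangeHom σ).map f₀) s) (2 * p) A ∈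
        algebraicClasses (fiberOver ((baseChangeHom σ).map f₀) s) p)
    (t : ComplexPoints ((baseChangeHom σ).obj S₀)) :
    complexBetti.map (fiberι ((baseChangeHom σ).map f₀) t) (2 * p) A ∈
      algebraicClasses (fiberOver ((baseChangeHom σ).map f₀) t) p :=
  h σ f₀ n p hS₀ hirr hf A s hs hA t

/-! ### The trivial degree ranges of the route decl, unconditionally -/

/-- **`HodgeLocusPropagation` in the degrees `p > n`, unconditionally** (no hypothesis on `𝒳₀`,
`S₀`, `s` or `A`): the fibre `𝒳_t` of a smooth projective family of relative dimension `n` is a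
smooth projective variety of dimension `n`, so `𝒳_t(ℂ)` is a closed `2n`-manifold and
`H²ᵖ(𝒳_t(ℂ); ℂ) = 0` for `2p > 2n` (the tree's `ComplexPoints.subsingleton_singularCohomology_of_lt`,
Hatcher Thm. 3.26 (c) + Thm. 3.2); hence `A|_{𝒳_t} = 0` is algebraic.
[cite: HatcherAT2002, §3.3 Thm. 3.26 (c)] -/
theorem HodgeLocusPropagation_of_lt {𝒳 S : SchemeOver ℂ} (f : 𝒳 ⟶ S) {n p : ℕ}
    (hf : IsSmoothProjectiveFamily f n) (hp : n < p) (A : complexBetti 𝒳 (2 * p))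
    (t : ComplexPoints S) :
    complexBetti.map (fiberι f t) (2 * p) A ∈ algebraicClasses (fiberOver f t) p := by
  haveI := Motives.ComplexPoints.subsingleton_singularCohomology_of_lt (hf.isSmoothProjective t) ℂ
    (k := 2 * p) (by omega)
  rw [Subsingleton.elim (complexBetti.map (fiberι f t) (2 * p) A) 0]
  exact Submodule.zero_mem _

/-- **`HodgeLocusPropagation` in degree `p = 0`, unconditionally**: every class in `H⁰` is
algebraic (`algebraicClasses_zero`: `N⁰ H⁰ = H⁰`, supported on `Z = X`). [folklore] -/
theorem HodgeLocusPropagation_zero {𝒳 S : SchemeOver ℂ} (f : 𝒳 ⟶ S) (A : complexBetti 𝒳 (2 * 0))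
    (t : ComplexPoints S) :
    complexBetti.map (fiberι f t) (2 * 0) A ∈ algebraicClasses (fiberOver f t) 0 := by
  rw [algebraicClasses_zero]
  exact Submodule.mem_top

/-- The route decl restricted to the trivial degree ranges `p = 0 ∨ n < p`, for ALL `𝒳₀`, `S₀`,
`s`, unconditionally (binder-for-binder the route decl with the extra hypothesis `p = 0 ∨ n < p`).
[folklore] -/
theorem HodgeLocusPropagation_of_eq_zero_or_lt
    (σ : AlgebraicClosure ℚ →+* ℂ) ⦃𝒳₀ S₀ : SchemeOver (AlgebraicClosure ℚ)⦄ (f₀ : 𝒳₀ ⟶ S₀)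
    (n p : ℕ) (hp : p = 0 ∨ n < p)
    (_hS₀ : ∃ (P : SchemeOver (AlgebraicClosure ℚ)) (j : S₀ ⟶ P),
        IsProjectiveOver P ∧ IsOpenImmersion j.left)
    (_hirr : IrreducibleSpace S₀.left)
    (hf : IsSmoothProjectiveFamily ((baseChangeHom σ).map f₀) n)
    (A : complexBetti ((baseChangeHom σ).obj 𝒳₀) (2 * p))
    (s : ComplexPoints ((baseChangeHom σ).obj S₀))
    (_hs : ∀ Z : Set (ComplexPoints ((baseChangeHom σ).obj S₀)),
        IsDefinedOverQbar σ S₀ Z → s ∈ Z → Z = Set.univ)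
    (_hA : complexBetti.map (fiberι ((baseChangeHom σ).map f₀) s) (2 * p) A ∈
        algebraicClasses (fiberOver ((baseChangeHom σ).map f₀) s) p)
    (t : ComplexPoints ((baseChangeHom σ).obj S₀)) :
    complexBetti.map (fiberι ((baseChangeHom σ).map f₀) t) (2 * p) A ∈
      algebraicClasses (fiberOver ((baseChangeHom σ).map f₀) t) p := by
  rcases hp with rfl | hlt
  · exact HodgeLocusPropagation_zero ((baseChangeHom σ).map f₀) A t
  · exact HodgeLocusPropagation_of_lt ((baseChangeHom σ).map f₀) hf hlt A t

end Summit.HodgeConjecture.HodgeConjecture.Theorems
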